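import Mathlib.Analysis.InnerProductSpace.PiL2
import Literature.Geometry.DiscreteGeometry.KissingPatterns
import Literature.MathematicalPhysics.StatisticalMechanics.LennardJonesClusters
import HarnessLib

/-!
# Line `separation-padding-transfer` for crux `ReggeStarCoercivity.StarCoercivity`
# (stmt-AtomisticToContinuum-13600): stub `stub_nearGoodCount` — at most `55` star-good sites
# lie within `6/5` of any point

A site `i` of a configuration `y : Fin N → ℝ³` is STAR-GOOD if for some `a ∈ [9/10, 11/10]` its
recentred, `a⁻¹`-rescaled shell of absolute radius `6/5`,
`T = {a⁻¹ • (y j - y i) : j ≠ i, dist (y i) (y j) ≤ 6/5}`, is `1/20`-matched after a linear isometry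
(`ShellCloseTo (1/20) T P`) to `P = fccKissingPattern` or `P = hcpKissingPattern`, both of which
consist of unit vectors.

* `one_sub_le_norm_of_shellCloseTo`: every point of a shell `η`-close to a pattern of unit vectors
  has norm `≥ 1 - η` (its match is the image of a unit vector under a linear isometry).
* `dist_ge_of_starGood` (KEY LEMMA): if `i` is star-good and `j ≠ i` lies in its absolute `6/5`-shell,
  then `dist (y i) (y j) ≥ a · (19/20) ≥ 171/200`.  In particular two distinct star-good sites never
  share a position.
* `card_le_of_near_of_separated` (PACKING): indices whose positions lie within `6/5` of a point `p`
  and are pairwise `≥ 171/200` apart number at most `55`, by the volume bound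
  `card_le_of_separated_of_dist_le`: `(2 · (6/5) / (171/200) + 1)³ = (651/171)³ < 56`.
* `stub_nearGoodCount`: the registered stub — at most `55` star-good sites of `y` lie within `6/5`
  of any point `p` (no injectivity hypothesis is needed). [folklore]
-/

noncomputable section

open scoped Classical

namespace Summit.AtomisticToContinuum.Crystallization.Theorems.SeparationPaddingTransfer

open Literature.Geometry.DiscreteGeometry Literature.MathematicalPhysics.StatisticalMechanics

/-- A point of a shell that is `η`-close, after a linear isometry, to a pattern of unit vectors has
norm at least `1 - η`: its match is `A v` with `‖A v‖ = ‖v‖ = 1`, at distance `≤ η`. [folklore] -/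
theorem one_sub_le_norm_of_shellCloseTo {η : ℝ} {T P : Finset (EuclideanSpace ℝ (Fin 3))}
    (hP : ∀ v ∈ P, ‖v‖ = 1) (h : ShellCloseTo η T P) {t : EuclideanSpace ℝ (Fin 3)} (ht : t ∈ T) :
    1 - η ≤ ‖t‖ := by
  obtain ⟨A, e, he⟩ := h
  obtain ⟨v, hv, hvA⟩ := Finset.mem_image.1 (e ⟨t, ht⟩).2
  have hnorm : ‖((e ⟨t, ht⟩ : ↥(P.image A)) : EuclideanSpace ℝ (Fin 3))‖ = 1 := by
    rw [← hvA, LinearIsometry.norm_map, hP v hv]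
  have hdist : dist t ((e ⟨t, ht⟩ : ↥(P.image A)) : EuclideanSpace ℝ (Fin 3)) ≤ η := he ⟨t, ht⟩
  rw [dist_comm, dist_eq_norm] at hdist
  have htri := norm_sub_norm_le ((e ⟨t, ht⟩ : ↥(P.image A)) : EuclideanSpace ℝ (Fin 3)) t
  linarith

/-- **Key lemma.** If site `i` is star-good (scale `a ∈ [9/10, 11/10]`, tolerance `1/20`), then every
site `j ≠ i` of its absolute `6/5`-shell is at distance `≥ 171/200 = (9/10)·(19/20)` from it:
`a⁻¹ • (y j - y i)` is a point of the matched shell, hence has norm `≥ 19/20`. [folklore] -/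
theorem dist_ge_of_starGood {N : ℕ} (y : Fin N → EuclideanSpace ℝ (Fin 3)) {i j : Fin N}
    (hgood : ∃ a : ℝ, 9 / 10 ≤ a ∧ a ≤ 11 / 10 ∧
      (ShellCloseTo (1 / 20) ((Finset.univ.filter fun j : Fin N => j ≠ i ∧ dist (y i) (y j) ≤ 6 / 5).image
          fun j => a⁻¹ • (y j - y i)) fccKissingPattern ∨
        ShellCloseTo (1 / 20) ((Finset.univ.filter fun j : Fin N => j ≠ i ∧ dist (y i) (y j) ≤ 6 / 5).image
          fun j => a⁻¹ • (y j - y i)) hcpKissingPattern))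
    (hji : j ≠ i) (hd : dist (y i) (y j) ≤ 6 / 5) : 171 / 200 ≤ dist (y i) (y j) := by
  obtain ⟨a, ha₁, -, hclose⟩ := hgood
  have ha : 0 < a := by linarith
  have hmem : a⁻¹ • (y j - y i) ∈
      (Finset.univ.filter fun j : Fin N => j ≠ i ∧ dist (y i) (y j) ≤ 6 / 5).image
        fun j => a⁻¹ • (y j - y i) :=
    Finset.mem_image_of_mem (fun j => a⁻¹ • (y j - y i))
      (Finset.mem_filter.2 ⟨Finset.mem_univ _, hji, hd⟩)
  have hnorm : 1 - 1 / 20 ≤ ‖a⁻¹ • (y j - y i)‖ := by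
    rcases hclose with h | h
    · exact one_sub_le_norm_of_shellCloseTo (fun v hv => norm_eq_one_of_mem_fccKissingPattern hv) h hmem
    · exact one_sub_le_norm_of_shellCloseTo (fun v hv => norm_eq_one_of_mem_hcpKissingPattern hv) h hmem
  rw [norm_smul, norm_inv, Real.norm_of_nonneg ha.le, ← dist_eq_norm, dist_comm,
    le_inv_mul_iff₀ ha] at hnorm
  linarith

/-- **Packing.** If the positions `y i`, `i ∈ S`, lie within `6/5` of a point `p` and are pairwise at
distance `≥ 171/200` (for distinct INDICES), then `S` has at most `55` elements: `y` is injective on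
`S`, and the volume bound `card_le_of_separated_of_dist_le` in `ℝ³` gives
`#S ≤ (2·(6/5)/(171/200) + 1)³ = (651/171)³ < 56`. [folklore] -/
theorem card_le_of_near_of_separated {N : ℕ} (y : Fin N → EuclideanSpace ℝ (Fin 3))
    (p : EuclideanSpace ℝ (Fin 3)) (S : Finset (Fin N))
    (hS : ∀ i ∈ S, dist (y i) p ≤ 6 / 5)
    (hsep : ∀ i ∈ S, ∀ j ∈ S, i ≠ j → 171 / 200 ≤ dist (y i) (y j)) : S.card ≤ 55 := by
  have hinj : Set.InjOn y ↑S := by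
    intro i hi j hj hij
    by_contra hne
    have h := hsep i hi j hj hne
    rw [hij, dist_self] at h
    norm_num at h
  have hcard : (S.image y).card = S.card := Finset.card_image_of_injOn hinj
  have h1 : ∀ c ∈ S.image y, dist c p ≤ 6 / 5 := by
    intro c hc
    obtain ⟨i, hi, rfl⟩ := Finset.mem_image.1 hc
    exact hS i hi
  have h2 : ∀ c ∈ S.image y, ∀ d ∈ S.image y, c ≠ d → 171 / 200 ≤ dist c d := by
    intro c hc d hd hcd
    obtain ⟨i, hi, rfl⟩ := Finset.mem_image.1 hc
    obtain ⟨j, hj, rfl⟩ := Finset.mem_image.1 hd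
    exact hsep i hi j hj fun h => hcd (by rw [h])
  have hbound := card_le_of_separated_of_dist_le (S.image y) p (by norm_num : (0 : ℝ) < 171 / 200)
    (by norm_num : (0 : ℝ) ≤ 6 / 5) h1 h2
  rw [finrank_euclideanSpace_fin, hcard] at hbound
  have hlt : (S.card : ℝ) < 56 := hbound.trans_lt (by norm_num)
  have hlt' : S.card < 56 := by exact_mod_cast hlt
  omega

/-- **Stub `stub_nearGoodCount`** (line `separation-padding-transfer`, crux stmt-AtomisticToContinuum-13600).
At most `55` STAR-GOOD sites of any configuration `y : Fin N → ℝ³` lie within `6/5` of a given point `p`: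
two distinct good sites within `6/5` of `p` are `≥ 171/200` apart (`dist_ge_of_starGood` if their distance
is `≤ 6/5`, trivially otherwise), and the packing bound `card_le_of_near_of_separated` applies.  No
injectivity hypothesis is needed. [folklore] -/
theorem stub_nearGoodCount : ∀ (N : ℕ) (y : Fin N → EuclideanSpace ℝ (Fin 3)) (p : EuclideanSpace ℝ (Fin 3)), ((Finset.univ.filter fun i : Fin N => dist (y i) p ≤ 6 / 5 ∧ ∃ a : ℝ, 9 / 10 ≤ a ∧ a ≤ 11 / 10 ∧ (Literature.Geometry.DiscreteGeometry.ShellCloseTo (1 / 20) ((Finset.univ.filter fun j : Fin N => j ≠ i ∧ dist (y i) (y j) ≤ 6 / 5).image fun j => a⁻¹ • (y j - y i)) Literature.Geometry.DiscreteGeometry.fccKissingPattern ∨ Literature.Geometry.DiscreteGeometry.ShellCloseTo (1 / 20) ((Finset.univ.filter fun j : Fin N => j ≠ i ∧ dist (y i) (y j) ≤ 6 / 5).image fun j => a⁻¹ • (y j - y i)) Literature.Geometry.DiscreteGeometry.hcpKissingPattern))).card ≤ 55 := by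
  intro N y p
  refine card_le_of_near_of_separated y p _ (fun i hi => (Finset.mem_filter.1 hi).2.1) ?_
  intro i hi j _ hij
  by_cases hd : dist (y i) (y j) ≤ 6 / 5
  · exact dist_ge_of_starGood y (Finset.mem_filter.1 hi).2.2 hij.symm hd
  · linarith [not_le.1 hd]

end Summit.AtomisticToContinuum.Crystallization.Theorems.SeparationPaddingTransfer

end
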